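import Mathlib
import Summits.NavierStokesRegularity.NavierStokesRegularity.Theorems.EulerZoomLiouvillePowerGaugeEulerLiouvilleHoopCircleInequality

/-!
# H-MODES (3/3): THE RADIAL INTEGRATION OF THE FIRST MODE and the per-slice form of the hoop lever (K-HOOP split (b);
HOOP-NOTE dc156936fff7 §4, the `m = ±1` bookkeeping in `t`)

Width piece for crux `EulerZoomLiouville.PowerGaugeEulerLiouville` (stmt-NavierStokesRegularity-19832); seat ns-ezl-w2 g5,
`--supports stmt-NavierStokesRegularity-19832 --as helper`.  Chart-free: the velocity components of one slice are abstract functions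
`a b : ℝ → ℝ → ℝ` of `(t, θ)` (`t` = distance to the axis, `θ` = angle), to be instantiated by the assembler with
`a t θ = V_r(axisPt σ t θ)`, `b t θ = V_θ(axisPt σ t θ)` (ns-ezl-w3 g6's H-FRAME / ns-sfl-p1 g7's H-CYL).

* `hasDerivAt_intervalIntegral_mul_weight` — differentiation under `∫₀^{2π} … dθ` of `t ↦ ∫ a t θ · w θ dθ` for jointly continuous
  `a`, `∂_t a` and a continuous weight `w` (dominated differentiation, as in `Condenser.hasDerivAt_circleAverage_radius`);
* `firstMode_energy_radial` — `∫_δ^T 2∫_θ (P₁(a t))·(∂_t a) dθ dt = E(T) − E(δ)`, `E(t) = π⁻¹((∫a t cos)² + (∫a t sin)²) = ∫_θ(P₁(a t))²`;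
* **`hoop_radial_le`** — for `0 < δ ≤ T`, with the transverse divergence relation `∂_θ b + a = −t(∂_t a + β)` (from `div V = 0`,
  `β = ∂_zV_z`): `∫_δ^T t⁻¹∫_θ(a² − b²) ≤ ∫_δ^T t⁻¹∫_θ[(∂_θa − b)² + (∂_θb + a)²] + E(δ) − E(T) − 2∫_δ^T∫_θ (P₁(a t))·β`
  (`hoop_circle_le` on each circle, divided by `t`, integrated; the `∂_t` part is `firstMode_energy_radial`).  As `δ → 0`,
  `E(δ) → π‖V_⊥(σe_z)‖²` — the axis atom; the `β`-term is integrated by parts in `σ` by the assembler (end-disc fluxes).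

HONEST FRAMING: 1-D/2-D calculus; proves nothing about the crux E (19832 OPEN), the hoop inequality as a whole, or Navier–Stokes
regularity. [folklore; HOOP-NOTE §4]
-/

noncomputable section

open Set Filter Topology Metric Function MeasureTheory Real
open scoped Interval

set_option linter.dupNamespace false

namespace Summit.NavierStokesRegularity.NavierStokesRegularity.Theorems.PowerGaugeEulerLiouville.HoopCore

/-- **Differentiation under `∫₀^{2π} … dθ` with a weight.**  If `a : ℝ → ℝ → ℝ` has `∂_t a t θ = ad t θ` everywhere with
`uncurry a`, `uncurry ad` continuous, and `w` is continuous, then `t ↦ ∫₀^{2π} a t θ · w θ dθ` has derivative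
`∫₀^{2π} ad t θ · w θ dθ`. [folklore] -/
theorem hasDerivAt_intervalIntegral_mul_weight {a ad : ℝ → ℝ → ℝ} (ha : ∀ t θ, HasDerivAt (fun t => a t θ) (ad t θ) t)
    (hac : Continuous (uncurry a)) (hatc : Continuous (uncurry ad)) {w : ℝ → ℝ} (hw : Continuous w) (t₀ : ℝ) :
    HasDerivAt (fun t => ∫ θ in (0 : ℝ)..2 * π, a t θ * w θ) (∫ θ in (0 : ℝ)..2 * π, ad t₀ θ * w θ) t₀ := by
  -- a uniform bound for `|ad t θ · w θ|` on `[t₀-1, t₀+1] × [0, 2π]`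
  have hK : IsCompact (Icc (t₀ - 1) (t₀ + 1) ×ˢ Icc (0 : ℝ) (2 * π)) := isCompact_Icc.prod isCompact_Icc
  have hFc : Continuous fun p : ℝ × ℝ => ad p.1 p.2 * w p.2 := hatc.mul (hw.comp continuous_snd)
  obtain ⟨M, hM⟩ := hK.exists_bound_of_continuousOn hFc.continuousOn
  have key := intervalIntegral.hasDerivAt_integral_of_dominated_loc_of_deriv_le
    (μ := volume) (a := 0) (b := 2 * π) (x₀ := t₀) (bound := fun _ => M)
    (F := fun t θ => a t θ * w θ) (F' := fun t θ => ad t θ * w θ)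
    (ball_mem_nhds t₀ zero_lt_one)
    (Eventually.of_forall fun t =>
      ((hac.comp (continuous_const.prodMk continuous_id)).mul hw).aestronglyMeasurable)
    (((hac.comp (continuous_const.prodMk continuous_id)).mul hw).intervalIntegrable _ _)
    ((hFc.comp (continuous_const.prodMk continuous_id)).aestronglyMeasurable)
    (Eventually.of_forall fun θ (hθ : θ ∈ Ι (0 : ℝ) (2 * π)) t (ht : t ∈ ball t₀ 1) => by
      have hθ' : θ ∈ Icc (0 : ℝ) (2 * π) := by
        rw [uIoc_of_le (by positivity : (0 : ℝ) ≤ 2 * π)] at hθ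
        exact Ioc_subset_Icc_self hθ
      have ht' : t ∈ Icc (t₀ - 1) (t₀ + 1) := by
        have : |t - t₀| < 1 := by rw [← Real.dist_eq]; exact ht
        rw [abs_lt] at this
        exact ⟨by linarith, by linarith⟩
      exact hM (t, θ) ⟨ht', hθ'⟩)
    intervalIntegrable_const
    (Eventually.of_forall fun θ _ t _ => (ha t θ).mul_const (w θ))
  exact key.2

/-- **The radial integration of the first-mode energy.**  With `C(t) = ∫₀^{2π} a t θ cos θ dθ`, `S(t) = ∫₀^{2π} a t θ sin θ dθ`
(so that `∫_θ (P₁(a t))² = π⁻¹(C² + S²)` and `2∫_θ (P₁(a t))·(∂_t a) = π⁻¹ d/dt (C² + S²)`): for all `δ T`,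
`∫_δ^T 2∫₀^{2π} (P₁(a t)) θ · ad t θ dθ dt = π⁻¹(C(T)² + S(T)²) − π⁻¹(C(δ)² + S(δ)²)`. [folklore] -/
theorem firstMode_energy_radial {a ad : ℝ → ℝ → ℝ} (ha : ∀ t θ, HasDerivAt (fun t => a t θ) (ad t θ) t)
    (hac : Continuous (uncurry a)) (hatc : Continuous (uncurry ad)) (δ T : ℝ) :
    ∫ t in δ..T, 2 * ∫ θ in (0 : ℝ)..2 * π,
        (π⁻¹ * (∫ y in (0 : ℝ)..2 * π, a t y * Real.cos y) * Real.cos θ +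
          π⁻¹ * (∫ y in (0 : ℝ)..2 * π, a t y * Real.sin y) * Real.sin θ) * ad t θ =
      π⁻¹ * ((∫ y in (0 : ℝ)..2 * π, a T y * Real.cos y) ^ 2 + (∫ y in (0 : ℝ)..2 * π, a T y * Real.sin y) ^ 2) -
        π⁻¹ * ((∫ y in (0 : ℝ)..2 * π, a δ y * Real.cos y) ^ 2 + (∫ y in (0 : ℝ)..2 * π, a δ y * Real.sin y) ^ 2) := by
  -- the two coefficient functions and their derivatives
  have hC : ∀ t, HasDerivAt (fun t => ∫ θ in (0 : ℝ)..2 * π, a t θ * Real.cos θ)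
      (∫ θ in (0 : ℝ)..2 * π, ad t θ * Real.cos θ) t :=
    fun t => hasDerivAt_intervalIntegral_mul_weight ha hac hatc continuous_cos t
  have hS : ∀ t, HasDerivAt (fun t => ∫ θ in (0 : ℝ)..2 * π, a t θ * Real.sin θ)
      (∫ θ in (0 : ℝ)..2 * π, ad t θ * Real.sin θ) t :=
    fun t => hasDerivAt_intervalIntegral_mul_weight ha hac hatc continuous_sin t
  -- the integrand at fixed `t` is a first-mode integral
  have hatc' : ∀ t, Continuous (ad t) := fun t => hatc.comp (continuous_const.prodMk continuous_id)
  have hinner : ∀ t, 2 * ∫ θ in (0 : ℝ)..2 * π,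
      (π⁻¹ * (∫ y in (0 : ℝ)..2 * π, a t y * Real.cos y) * Real.cos θ +
        π⁻¹ * (∫ y in (0 : ℝ)..2 * π, a t y * Real.sin y) * Real.sin θ) * ad t θ =
      2 * (π⁻¹ * (∫ y in (0 : ℝ)..2 * π, a t y * Real.cos y) * (∫ θ in (0 : ℝ)..2 * π, ad t θ * Real.cos θ) +
        π⁻¹ * (∫ y in (0 : ℝ)..2 * π, a t y * Real.sin y) * (∫ θ in (0 : ℝ)..2 * π, ad t θ * Real.sin θ)) := by
    intro t; rw [integral_firstMode_mul (hatc' t)]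
  -- the energy `E(t) = π⁻¹ (C² + S²)` has derivative the integrand
  have hE : ∀ t, HasDerivAt (fun t => π⁻¹ * ((∫ y in (0 : ℝ)..2 * π, a t y * Real.cos y) ^ 2 +
      (∫ y in (0 : ℝ)..2 * π, a t y * Real.sin y) ^ 2))
      (2 * (π⁻¹ * (∫ y in (0 : ℝ)..2 * π, a t y * Real.cos y) * (∫ θ in (0 : ℝ)..2 * π, ad t θ * Real.cos θ) +
        π⁻¹ * (∫ y in (0 : ℝ)..2 * π, a t y * Real.sin y) * (∫ θ in (0 : ℝ)..2 * π, ad t θ * Real.sin θ))) t := by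
    intro t
    have h := (((hC t).pow 2).add ((hS t).pow 2)).const_mul π⁻¹
    refine h.congr_deriv ?_
    simp only [Nat.cast_ofNat]
    ring
  -- continuity of the derivative in `t` (parametric integrals of jointly continuous functions)
  have hCc : Continuous fun t => ∫ θ in (0 : ℝ)..2 * π, ad t θ * Real.cos θ :=
    intervalIntegral.continuous_parametric_intervalIntegral_of_continuous' (f := fun t θ => ad t θ * Real.cos θ)
      (hatc.mul (continuous_cos.comp continuous_snd)) _ _
  have hSc : Continuous fun t => ∫ θ in (0 : ℝ)..2 * π, ad t θ * Real.sin θ :=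
    intervalIntegral.continuous_parametric_intervalIntegral_of_continuous' (f := fun t θ => ad t θ * Real.sin θ)
      (hatc.mul (continuous_sin.comp continuous_snd)) _ _
  have hC0c : Continuous fun t => ∫ y in (0 : ℝ)..2 * π, a t y * Real.cos y :=
    continuous_iff_continuousAt.2 fun t => (hC t).continuousAt
  have hS0c : Continuous fun t => ∫ y in (0 : ℝ)..2 * π, a t y * Real.sin y :=
    continuous_iff_continuousAt.2 fun t => (hS t).continuousAt
  have hderc : Continuous fun t => 2 * (π⁻¹ * (∫ y in (0 : ℝ)..2 * π, a t y * Real.cos y) *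
      (∫ θ in (0 : ℝ)..2 * π, ad t θ * Real.cos θ) +
        π⁻¹ * (∫ y in (0 : ℝ)..2 * π, a t y * Real.sin y) * (∫ θ in (0 : ℝ)..2 * π, ad t θ * Real.sin θ)) :=
    continuous_const.mul (((continuous_const.mul hC0c).mul hCc).add ((continuous_const.mul hS0c).mul hSc))
  rw [intervalIntegral.integral_congr fun t _ => hinner t]
  exact intervalIntegral.integral_eq_sub_of_hasDerivAt (fun t _ => hE t) (hderc.intervalIntegrable _ _)


/-- The first-mode energy of a pure first mode: if `a 0 θ = v₀ cos θ + v₁ sin θ` (the trace of a continuous field on the axis, seen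
in the frame `e_r(θ)`), then `π⁻¹((∫ a cos)² + (∫ a sin)²) = π (v₀² + v₁²)` — the AXIS ATOM `π‖v_⊥‖²` of the hoop inequality. -/
theorem firstMode_energy_of_firstMode (v₀ v₁ : ℝ) :
    π⁻¹ * ((∫ y in (0 : ℝ)..2 * π, (v₀ * Real.cos y + v₁ * Real.sin y) * Real.cos y) ^ 2 +
        (∫ y in (0 : ℝ)..2 * π, (v₀ * Real.cos y + v₁ * Real.sin y) * Real.sin y) ^ 2) = π * (v₀ ^ 2 + v₁ ^ 2) := by
  have hc : ∫ y in (0 : ℝ)..2 * π, (v₀ * Real.cos y + v₁ * Real.sin y) * Real.cos y = π * v₀ := by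
    have h := integral_firstMode_mul_firstMode v₀ v₁ 1 0
    simp only [one_mul, zero_mul, add_zero, mul_one, mul_zero] at h
    exact h
  have hs : ∫ y in (0 : ℝ)..2 * π, (v₀ * Real.cos y + v₁ * Real.sin y) * Real.sin y = π * v₁ := by
    have h := integral_firstMode_mul_firstMode v₀ v₁ 0 1
    simp only [one_mul, zero_mul, zero_add, mul_one, mul_zero] at h
    exact h
  rw [hc, hs]
  field_simp

/-- **The hoop lever on an annulus `δ ≤ t ≤ T` of one slice (radial integration of `hoop_circle_le`).**  Data: jointly continuous
`a b : ℝ → ℝ → ℝ` (`a t θ = V_r`, `b t θ = V_θ` on the circle of radius `t`), their `θ`-derivatives `aθ bθ`, the `t`-derivative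
`ad` of `a`, and `β` (`= ∂_zV_z`), `2π`-periodic in `θ`, tied by the transverse divergence relation `∂_θb + a = −t(∂_ta + β)`
(`div V = 0` in the frame `(e_r, e_θ, e_z)`).  Then, with `E(t) = π⁻¹((∫a t cos)² + (∫a t sin)²)` and
`P₁(a t) θ = π⁻¹(∫a t cos) cos θ + π⁻¹(∫a t sin) sin θ`:
`∫_δ^T t⁻¹∫_θ (a² − b²) ≤ ∫_δ^T t⁻¹∫_θ [(aθ − b)² + (bθ + a)²] + E(δ) − E(T) − 2∫_δ^T∫_θ P₁(a t)·β`.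
(The integrand on the right is `t·[(t⁻¹(∂_θV_r − V_θ))² + (t⁻¹(∂_θV_θ + V_r))²]`, two entries of `t|DV|_F²` in the polar frame.)
[HOOP-NOTE §4; folklore] -/
theorem hoop_radial_le {a b aθ bθ ad β : ℝ → ℝ → ℝ} {δ T : ℝ} (hδ : 0 < δ) (hδT : δ ≤ T)
    (haθ : ∀ t θ, HasDerivAt (fun θ => a t θ) (aθ t θ) θ) (hbθ : ∀ t θ, HasDerivAt (fun θ => b t θ) (bθ t θ) θ)
    (had : ∀ t θ, HasDerivAt (fun t => a t θ) (ad t θ) t)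
    (hac : Continuous (uncurry a)) (hbc : Continuous (uncurry b)) (haθc : Continuous (uncurry aθ))
    (hbθc : Continuous (uncurry bθ)) (hadc : Continuous (uncurry ad)) (hβc : Continuous (uncurry β))
    (haper : ∀ t, a t (2 * π) = a t 0) (hbper : ∀ t, b t (2 * π) = b t 0)
    (hdiv : ∀ t θ, bθ t θ + a t θ = -(t * (ad t θ + β t θ))) :
    ∫ t in δ..T, t⁻¹ * ∫ θ in (0 : ℝ)..2 * π, (a t θ ^ 2 - b t θ ^ 2) ≤
      (∫ t in δ..T, t⁻¹ * ∫ θ in (0 : ℝ)..2 * π, ((aθ t θ - b t θ) ^ 2 + (bθ t θ + a t θ) ^ 2))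
        + π⁻¹ * ((∫ y in (0 : ℝ)..2 * π, a δ y * Real.cos y) ^ 2 + (∫ y in (0 : ℝ)..2 * π, a δ y * Real.sin y) ^ 2)
        - π⁻¹ * ((∫ y in (0 : ℝ)..2 * π, a T y * Real.cos y) ^ 2 + (∫ y in (0 : ℝ)..2 * π, a T y * Real.sin y) ^ 2)
        - 2 * ∫ t in δ..T, ∫ θ in (0 : ℝ)..2 * π,
            (π⁻¹ * (∫ y in (0 : ℝ)..2 * π, a t y * Real.cos y) * Real.cos θ +
              π⁻¹ * (∫ y in (0 : ℝ)..2 * π, a t y * Real.sin y) * Real.sin θ) * β t θ := by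
  -- sections at fixed `t` are continuous
  have hsec : ∀ {f : ℝ → ℝ → ℝ}, Continuous (uncurry f) → ∀ t, Continuous (f t) :=
    fun hf t => hf.comp (continuous_const.prodMk continuous_id)
  -- the coefficient functions `C, S` are continuous in `t`
  have hCc : Continuous fun t => ∫ y in (0 : ℝ)..2 * π, a t y * Real.cos y :=
    intervalIntegral.continuous_parametric_intervalIntegral_of_continuous' (f := fun t y => a t y * Real.cos y)
      (hac.mul (continuous_cos.comp continuous_snd)) _ _
  have hSc : Continuous fun t => ∫ y in (0 : ℝ)..2 * π, a t y * Real.sin y :=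
    intervalIntegral.continuous_parametric_intervalIntegral_of_continuous' (f := fun t y => a t y * Real.sin y)
      (hac.mul (continuous_sin.comp continuous_snd)) _ _
  -- joint continuity of `(t, θ) ↦ P₁(a t) θ`
  have hPc : Continuous fun p : ℝ × ℝ => π⁻¹ * (∫ y in (0 : ℝ)..2 * π, a p.1 y * Real.cos y) * Real.cos p.2 +
      π⁻¹ * (∫ y in (0 : ℝ)..2 * π, a p.1 y * Real.sin y) * Real.sin p.2 :=
    ((continuous_const.mul (hCc.comp continuous_fst)).mul (continuous_cos.comp continuous_snd)).add
      ((continuous_const.mul (hSc.comp continuous_fst)).mul (continuous_sin.comp continuous_snd))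
  -- the radial integrands are continuous
  have hac' : Continuous fun p : ℝ × ℝ => a p.1 p.2 := hac
  have hbc' : Continuous fun p : ℝ × ℝ => b p.1 p.2 := hbc
  have haθc' : Continuous fun p : ℝ × ℝ => aθ p.1 p.2 := haθc
  have hbθc' : Continuous fun p : ℝ × ℝ => bθ p.1 p.2 := hbθc
  have hj1 : Continuous fun p : ℝ × ℝ => a p.1 p.2 ^ 2 - b p.1 p.2 ^ 2 := by fun_prop
  have hj2 : Continuous fun p : ℝ × ℝ => (aθ p.1 p.2 - b p.1 p.2) ^ 2 + (bθ p.1 p.2 + a p.1 p.2) ^ 2 := by fun_prop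
  have hF1c : Continuous fun t => ∫ θ in (0 : ℝ)..2 * π, (a t θ ^ 2 - b t θ ^ 2) :=
    intervalIntegral.continuous_parametric_intervalIntegral_of_continuous' (f := fun t θ => a t θ ^ 2 - b t θ ^ 2)
      hj1 _ _
  have hF2c : Continuous fun t => ∫ θ in (0 : ℝ)..2 * π, ((aθ t θ - b t θ) ^ 2 + (bθ t θ + a t θ) ^ 2) :=
    intervalIntegral.continuous_parametric_intervalIntegral_of_continuous'
      (f := fun t θ => (aθ t θ - b t θ) ^ 2 + (bθ t θ + a t θ) ^ 2) hj2 _ _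
  have hGc : Continuous fun t => ∫ θ in (0 : ℝ)..2 * π,
      (π⁻¹ * (∫ y in (0 : ℝ)..2 * π, a t y * Real.cos y) * Real.cos θ +
        π⁻¹ * (∫ y in (0 : ℝ)..2 * π, a t y * Real.sin y) * Real.sin θ) * ad t θ :=
    intervalIntegral.continuous_parametric_intervalIntegral_of_continuous'
      (f := fun t θ => (π⁻¹ * (∫ y in (0 : ℝ)..2 * π, a t y * Real.cos y) * Real.cos θ +
        π⁻¹ * (∫ y in (0 : ℝ)..2 * π, a t y * Real.sin y) * Real.sin θ) * ad t θ) (hPc.mul hadc) _ _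
  have hKc : Continuous fun t => ∫ θ in (0 : ℝ)..2 * π,
      (π⁻¹ * (∫ y in (0 : ℝ)..2 * π, a t y * Real.cos y) * Real.cos θ +
        π⁻¹ * (∫ y in (0 : ℝ)..2 * π, a t y * Real.sin y) * Real.sin θ) * β t θ :=
    intervalIntegral.continuous_parametric_intervalIntegral_of_continuous'
      (f := fun t θ => (π⁻¹ * (∫ y in (0 : ℝ)..2 * π, a t y * Real.cos y) * Real.cos θ +
        π⁻¹ * (∫ y in (0 : ℝ)..2 * π, a t y * Real.sin y) * Real.sin θ) * β t θ) (hPc.mul hβc) _ _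
  -- `t⁻¹` is continuous on `[δ, T]`
  have hinv : ContinuousOn (fun t : ℝ => t⁻¹) (Icc δ T) :=
    continuousOn_inv₀.mono fun t ht => Set.mem_compl_singleton_iff.2 (ne_of_gt (lt_of_lt_of_le hδ ht.1))
  have hIcc : uIcc δ T = Icc δ T := uIcc_of_le hδT
  -- pointwise in `t`: the circle inequality, the divergence relation, division by `t`
  have hpt : ∀ t ∈ Icc δ T,
      t⁻¹ * ∫ θ in (0 : ℝ)..2 * π, (a t θ ^ 2 - b t θ ^ 2) ≤
        t⁻¹ * (∫ θ in (0 : ℝ)..2 * π, ((aθ t θ - b t θ) ^ 2 + (bθ t θ + a t θ) ^ 2)) -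
          2 * (∫ θ in (0 : ℝ)..2 * π,
            (π⁻¹ * (∫ y in (0 : ℝ)..2 * π, a t y * Real.cos y) * Real.cos θ +
              π⁻¹ * (∫ y in (0 : ℝ)..2 * π, a t y * Real.sin y) * Real.sin θ) * ad t θ) -
          2 * ∫ θ in (0 : ℝ)..2 * π,
            (π⁻¹ * (∫ y in (0 : ℝ)..2 * π, a t y * Real.cos y) * Real.cos θ +
              π⁻¹ * (∫ y in (0 : ℝ)..2 * π, a t y * Real.sin y) * Real.sin θ) * β t θ := by
    intro t ht
    have ht0 : 0 < t := lt_of_lt_of_le hδ ht.1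
    have hc := hoop_circle_le (haθ t) (hsec haθc t) (haper t) (hbθ t) (hsec hbθc t) (hbper t)
    have hPt : Continuous fun θ => π⁻¹ * (∫ y in (0 : ℝ)..2 * π, a t y * Real.cos y) * Real.cos θ +
        π⁻¹ * (∫ y in (0 : ℝ)..2 * π, a t y * Real.sin y) * Real.sin θ :=
      hPc.comp (continuous_const.prodMk continuous_id)
    have h1 : IntervalIntegrable (fun θ => -t * ((π⁻¹ * (∫ y in (0 : ℝ)..2 * π, a t y * Real.cos y) * Real.cos θ +
        π⁻¹ * (∫ y in (0 : ℝ)..2 * π, a t y * Real.sin y) * Real.sin θ) * ad t θ)) volume 0 (2 * π) :=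
      ((hPt.mul (hsec hadc t)).const_mul (-t)).intervalIntegrable _ _
    have h2 : IntervalIntegrable (fun θ => -t * ((π⁻¹ * (∫ y in (0 : ℝ)..2 * π, a t y * Real.cos y) * Real.cos θ +
        π⁻¹ * (∫ y in (0 : ℝ)..2 * π, a t y * Real.sin y) * Real.sin θ) * β t θ)) volume 0 (2 * π) :=
      ((hPt.mul (hsec hβc t)).const_mul (-t)).intervalIntegrable _ _
    have hlast : ∫ θ in (0 : ℝ)..2 * π,
        (π⁻¹ * (∫ y in (0 : ℝ)..2 * π, a t y * Real.cos y) * Real.cos θ +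
          π⁻¹ * (∫ y in (0 : ℝ)..2 * π, a t y * Real.sin y) * Real.sin θ) * (bθ t θ + a t θ) =
        -t * (∫ θ in (0 : ℝ)..2 * π,
            (π⁻¹ * (∫ y in (0 : ℝ)..2 * π, a t y * Real.cos y) * Real.cos θ +
              π⁻¹ * (∫ y in (0 : ℝ)..2 * π, a t y * Real.sin y) * Real.sin θ) * ad t θ) +
          -t * ∫ θ in (0 : ℝ)..2 * π,
            (π⁻¹ * (∫ y in (0 : ℝ)..2 * π, a t y * Real.cos y) * Real.cos θ +
              π⁻¹ * (∫ y in (0 : ℝ)..2 * π, a t y * Real.sin y) * Real.sin θ) * β t θ := by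
      rw [← intervalIntegral.integral_const_mul (-t), ← intervalIntegral.integral_const_mul (-t),
        ← intervalIntegral.integral_add h1 h2]
      refine intervalIntegral.integral_congr fun θ _ => ?_
      simp only [hdiv t θ]
      ring
    rw [hlast] at hc
    have h3 := mul_le_mul_of_nonneg_left hc (inv_nonneg.2 ht0.le)
    have hinvt : t⁻¹ * t = 1 := inv_mul_cancel₀ ht0.ne'
    calc _ ≤ _ := h3
      _ = _ := by
        linear_combination (-(2 * (∫ θ in (0 : ℝ)..2 * π,
            (π⁻¹ * (∫ y in (0 : ℝ)..2 * π, a t y * Real.cos y) * Real.cos θ +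
              π⁻¹ * (∫ y in (0 : ℝ)..2 * π, a t y * Real.sin y) * Real.sin θ) * ad t θ) +
          2 * ∫ θ in (0 : ℝ)..2 * π,
            (π⁻¹ * (∫ y in (0 : ℝ)..2 * π, a t y * Real.cos y) * Real.cos θ +
              π⁻¹ * (∫ y in (0 : ℝ)..2 * π, a t y * Real.sin y) * Real.sin θ) * β t θ)) * hinvt
  -- interval integrability on `[δ, T]`
  have hI1 : IntervalIntegrable (fun t => t⁻¹ * ∫ θ in (0 : ℝ)..2 * π, (a t θ ^ 2 - b t θ ^ 2)) volume δ T :=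
    ContinuousOn.intervalIntegrable (by rw [hIcc]; exact hinv.mul hF1c.continuousOn)
  have hI2 : IntervalIntegrable
      (fun t => t⁻¹ * ∫ θ in (0 : ℝ)..2 * π, ((aθ t θ - b t θ) ^ 2 + (bθ t θ + a t θ) ^ 2)) volume δ T :=
    ContinuousOn.intervalIntegrable (by rw [hIcc]; exact hinv.mul hF2c.continuousOn)
  have hIG : IntervalIntegrable (fun t => 2 * ∫ θ in (0 : ℝ)..2 * π,
      (π⁻¹ * (∫ y in (0 : ℝ)..2 * π, a t y * Real.cos y) * Real.cos θ +
        π⁻¹ * (∫ y in (0 : ℝ)..2 * π, a t y * Real.sin y) * Real.sin θ) * ad t θ) volume δ T :=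
    (continuous_const.mul hGc).intervalIntegrable _ _
  have hIK : IntervalIntegrable (fun t => 2 * ∫ θ in (0 : ℝ)..2 * π,
      (π⁻¹ * (∫ y in (0 : ℝ)..2 * π, a t y * Real.cos y) * Real.cos θ +
        π⁻¹ * (∫ y in (0 : ℝ)..2 * π, a t y * Real.sin y) * Real.sin θ) * β t θ) volume δ T :=
    (continuous_const.mul hKc).intervalIntegrable _ _
  have hmono := intervalIntegral.integral_mono_on hδT hI1 ((hI2.sub hIG).sub hIK) hpt
  rw [intervalIntegral.integral_sub (hI2.sub hIG) hIK, intervalIntegral.integral_sub hI2 hIG,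
    firstMode_energy_radial had hac hadc δ T, intervalIntegral.integral_const_mul] at hmono
  linarith

/-- **The hoop lever on a full slice `0 ≤ t ≤ T` (`δ → 0` in `hoop_radial_le`).**  Same data, now used down to the axis:
if the two `t⁻¹`-weighted radial integrands are interval-integrable on `[0, T]` (for `a, b` the polar components of a `C¹` field
they are even continuous: `aθ − b = t⟨DV e_θ, e_r⟩`, `bθ + a = t⟨DV e_θ, e_θ⟩`, and the hoop integrand is `O(1)`), then
`∫_0^T t⁻¹∫_θ (a² − b²) ≤ ∫_0^T t⁻¹∫_θ [(aθ − b)² + (bθ + a)²] + E(0) − E(T) − 2∫_0^T∫_θ P₁(a t)·β`,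
where `E(0) = π⁻¹((∫ a 0 cos)² + (∫ a 0 sin)²)` is the AXIS ATOM (`= π‖v_⊥‖²` when `a 0 θ = ⟨v, e_r(θ)⟩`,
`firstMode_energy_of_firstMode`). [HOOP-NOTE §4; folklore] -/
theorem hoop_slice_le {a b aθ bθ ad β : ℝ → ℝ → ℝ} {T : ℝ} (hT : 0 < T)
    (haθ : ∀ t θ, HasDerivAt (fun θ => a t θ) (aθ t θ) θ) (hbθ : ∀ t θ, HasDerivAt (fun θ => b t θ) (bθ t θ) θ)
    (had : ∀ t θ, HasDerivAt (fun t => a t θ) (ad t θ) t)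
    (hac : Continuous (uncurry a)) (hbc : Continuous (uncurry b)) (haθc : Continuous (uncurry aθ))
    (hbθc : Continuous (uncurry bθ)) (hadc : Continuous (uncurry ad)) (hβc : Continuous (uncurry β))
    (haper : ∀ t, a t (2 * π) = a t 0) (hbper : ∀ t, b t (2 * π) = b t 0)
    (hdiv : ∀ t θ, bθ t θ + a t θ = -(t * (ad t θ + β t θ)))
    (hint₁ : IntervalIntegrable (fun t => t⁻¹ * ∫ θ in (0 : ℝ)..2 * π, (a t θ ^ 2 - b t θ ^ 2)) volume 0 T)
    (hint₂ : IntervalIntegrable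
      (fun t => t⁻¹ * ∫ θ in (0 : ℝ)..2 * π, ((aθ t θ - b t θ) ^ 2 + (bθ t θ + a t θ) ^ 2)) volume 0 T) :
    ∫ t in (0 : ℝ)..T, t⁻¹ * ∫ θ in (0 : ℝ)..2 * π, (a t θ ^ 2 - b t θ ^ 2) ≤
      (∫ t in (0 : ℝ)..T, t⁻¹ * ∫ θ in (0 : ℝ)..2 * π, ((aθ t θ - b t θ) ^ 2 + (bθ t θ + a t θ) ^ 2))
        + π⁻¹ * ((∫ y in (0 : ℝ)..2 * π, a 0 y * Real.cos y) ^ 2 + (∫ y in (0 : ℝ)..2 * π, a 0 y * Real.sin y) ^ 2)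
        - π⁻¹ * ((∫ y in (0 : ℝ)..2 * π, a T y * Real.cos y) ^ 2 + (∫ y in (0 : ℝ)..2 * π, a T y * Real.sin y) ^ 2)
        - 2 * ∫ t in (0 : ℝ)..T, ∫ θ in (0 : ℝ)..2 * π,
            (π⁻¹ * (∫ y in (0 : ℝ)..2 * π, a t y * Real.cos y) * Real.cos θ +
              π⁻¹ * (∫ y in (0 : ℝ)..2 * π, a t y * Real.sin y) * Real.sin θ) * β t θ := by
  have hIcc : uIcc (0 : ℝ) T = Icc 0 T := uIcc_of_le hT.le
  -- continuity in `t` of the coefficient functions and of the `β`-integrand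
  have hCc : Continuous fun t => ∫ y in (0 : ℝ)..2 * π, a t y * Real.cos y :=
    intervalIntegral.continuous_parametric_intervalIntegral_of_continuous' (f := fun t y => a t y * Real.cos y)
      (hac.mul (continuous_cos.comp continuous_snd)) _ _
  have hSc : Continuous fun t => ∫ y in (0 : ℝ)..2 * π, a t y * Real.sin y :=
    intervalIntegral.continuous_parametric_intervalIntegral_of_continuous' (f := fun t y => a t y * Real.sin y)
      (hac.mul (continuous_sin.comp continuous_snd)) _ _
  have hPc : Continuous fun p : ℝ × ℝ => π⁻¹ * (∫ y in (0 : ℝ)..2 * π, a p.1 y * Real.cos y) * Real.cos p.2 +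
      π⁻¹ * (∫ y in (0 : ℝ)..2 * π, a p.1 y * Real.sin y) * Real.sin p.2 :=
    ((continuous_const.mul (hCc.comp continuous_fst)).mul (continuous_cos.comp continuous_snd)).add
      ((continuous_const.mul (hSc.comp continuous_fst)).mul (continuous_sin.comp continuous_snd))
  have hKc : Continuous fun t => ∫ θ in (0 : ℝ)..2 * π,
      (π⁻¹ * (∫ y in (0 : ℝ)..2 * π, a t y * Real.cos y) * Real.cos θ +
        π⁻¹ * (∫ y in (0 : ℝ)..2 * π, a t y * Real.sin y) * Real.sin θ) * β t θ :=
    intervalIntegral.continuous_parametric_intervalIntegral_of_continuous'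
      (f := fun t θ => (π⁻¹ * (∫ y in (0 : ℝ)..2 * π, a t y * Real.cos y) * Real.cos θ +
        π⁻¹ * (∫ y in (0 : ℝ)..2 * π, a t y * Real.sin y) * Real.sin θ) * β t θ) (hPc.mul hβc) _ _
  have hEc : Continuous fun t => π⁻¹ * ((∫ y in (0 : ℝ)..2 * π, a t y * Real.cos y) ^ 2 +
      (∫ y in (0 : ℝ)..2 * π, a t y * Real.sin y) ^ 2) := continuous_const.mul ((hCc.pow 2).add (hSc.pow 2))
  -- the lower-limit primitives are continuous on `[0, T]`, hence tend to their value at `0` along `𝓝[>] 0`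
  have hle : 𝓝[>] (0 : ℝ) ≤ 𝓝[Icc 0 T] 0 := nhdsWithin_le_of_mem (Icc_mem_nhdsGT hT)
  have hprim : ∀ {g : ℝ → ℝ}, IntervalIntegrable g volume 0 T →
      Tendsto (fun δ => ∫ t in δ..T, g t) (𝓝[>] 0) (𝓝 (∫ t in (0 : ℝ)..T, g t)) := by
    intro g hg
    have hg' : IntegrableOn g (uIcc 0 T) volume := (intervalIntegrable_iff').1 hg
    have hc := intervalIntegral.continuousOn_primitive_interval_left hg'
    rw [hIcc] at hc
    exact ((hc 0 ⟨le_rfl, hT.le⟩).tendsto).mono_left hle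
  have h1 := hprim hint₁
  have h2 := hprim hint₂
  have h3 := hprim (hKc.intervalIntegrable 0 T)
  have h4 : Tendsto (fun δ => π⁻¹ * ((∫ y in (0 : ℝ)..2 * π, a δ y * Real.cos y) ^ 2 +
      (∫ y in (0 : ℝ)..2 * π, a δ y * Real.sin y) ^ 2)) (𝓝[>] 0)
      (𝓝 (π⁻¹ * ((∫ y in (0 : ℝ)..2 * π, a 0 y * Real.cos y) ^ 2 +
        (∫ y in (0 : ℝ)..2 * π, a 0 y * Real.sin y) ^ 2))) :=
    (hEc.tendsto 0).mono_left nhdsWithin_le_nhds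
  refine le_of_tendsto_of_tendsto h1 (((h2.add h4).sub tendsto_const_nhds).sub (h3.const_mul 2)) ?_
  filter_upwards [self_mem_nhdsWithin, Ioc_mem_nhdsGT hT] with δ hδ hδT
  exact hoop_radial_le hδ hδT.2 haθ hbθ had hac hbc haθc hbθc hadc hβc haper hbper hdiv

end Summit.NavierStokesRegularity.NavierStokesRegularity.Theorems.PowerGaugeEulerLiouville.HoopCore

end
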